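import Mathlib
import Literature.MathematicalPhysics.QuantumFieldTheory.Luscher2010.TrivializingMaps
import Summits.Ventures.LatticeQCDFlow.TrivializingMaps.Truncation
import Summits.Ventures.LatticeQCDFlow.TrivializingMaps.LocalModeNorm
import Summits.Ventures.LatticeQCDFlow.TrivializingMaps.TheoremAReduction
import HarnessLib

/-!
# THEOREM A and Lüscher's volume-uniform radius, modulo the local mode norm (assembly; all PROVED)

HONEST FRAMING: exact (Metropolis-corrected) sampling algorithms for lattice gauge theory; figures of merit
are autocorrelation/cost numbers at stated couplings and volumes; no continuum-physics claim.

Proposed tree file: `Summits/Ventures/LatticeQCDFlow/TrivializingMaps/LocalModeNormTheoremA.lean` (venture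
side; namespace `Summit.Ventures.LatticeQCDFlow.TrivializingMaps`). Theorems only; no `sorry`, no new axioms;
nothing is asserted about the obligation `HasLocalModeNorm` (`LocalModeNorm.lean`, `@[conjecture]`, ours).

The cell's one open analytic statement, THEOREM A = `LuscherGeometricGradientBound d n` (`Truncation.lean` §6;
volume-uniform geometric bound on the link gradients of EVERY smooth Lüscher series of the Wilson action in
EVERY basis), follows from the local mode norm obligation for ONE basis `B₀`:

  `HasLocalModeNorm d n B₀`                                   (Peter–Weyl bookkeeping; THEORY-1 §12.2)
    ⟹ fixed-basis bound for `wilsonSk d L B₀`                 (`fixedBasisGradientBound_of_hasLocalModeNorm`: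
                                                               contraction + iteration, `MassTransferContraction`)
    ⟹ `LuscherGeometricGradientBound d n`                     (`luscherGeometricGradientBound_iff_fixedBasis`,
                                                               `TheoremAReduction.lean`: one series, one basis)
    ⟹ `LuscherUniformRadius d n 1`                            (`luscherUniformRadius_one_of_geometric`)
and, composing further with `logDepthWilsonFlowSampler_of_geometric` (`LogDepthWilsonFlowSampler.lean`), the
LOG-DEPTH LAW for the exact order-`N` Wilson-flow sampler. CAUTION (theory-1 GEN-9): `HasLocalModeNorm d n B₀`
is EQUIVALENT to THEOREM A (`LocalModeNormEquivalence.lean`: the one-mode bookkeeping inhabits the structure as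
soon as the gradients are geometrically bounded), so this file assembles an INTERFACE through which every proof
factors — the shape of the intended Peter–Weyl proof (THEORY-1 §12.2 (F1)–(F5); its `U(1)` analogue is
kernel-checked, `Abelian*.lean`) — and is NOT a reduction of difficulty: the open formal node is THEOREM A.
-/

namespace Summit.Ventures.LatticeQCDFlow.TrivializingMaps

open Literature.MathematicalPhysics.QuantumFieldTheory
open Literature.MathematicalPhysics.QuantumFieldTheory.Luscher2010

/-- **THEOREM A modulo the local mode norm (ours; PROVED).** For any orthonormal basis `B₀` of `𝔰𝔲(n)`:
`HasLocalModeNorm d n B₀ → LuscherGeometricGradientBound d n`. [ours] -/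
theorem luscherGeometricGradientBound_of_hasLocalModeNorm {d n : ℕ} (B₀ : SuBasis n)
    (h : HasLocalModeNorm d n B₀) : LuscherGeometricGradientBound d n :=
  (luscherGeometricGradientBound_iff_fixedBasis d n B₀).2 (fixedBasisGradientBound_of_hasLocalModeNorm h)

/-- **Lüscher's volume-uniform radius (§4.5(b)) at `β = 1`, modulo the local mode norm (ours; PROVED).**
[ours] -/
theorem luscherUniformRadius_one_of_hasLocalModeNorm {d n : ℕ} (B₀ : SuBasis n)
    (h : HasLocalModeNorm d n B₀) : LuscherUniformRadius d n 1 :=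
  luscherUniformRadius_one_of_geometric (luscherGeometricGradientBound_of_hasLocalModeNorm B₀ h)

end Summit.Ventures.LatticeQCDFlow.TrivializingMaps
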